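import Mathlib
import Summits.ValiantsHypothesis.ValiantsHypothesis.Theorems.ProofCarryingSymmetryRestorationQPACReach

/-!
# Route ProofCarryingSymmetry — crux `RestorationQP`, line `registered`, stub S3 (`stub_stabilityAtACBudget`), part 4:
size bookkeeping of unfoldings; the gate sets

Continuation of `…RestorationQPACReach.lean`.  For a Hrubeš–Tzameret circuit `C` (`PICircuit`,
straight-line presentation, junk child references unfold to the leaf `0`):

* the distinct subformulas of the unfolding `C•` are `C•`, the junk leaf `0` and the unfoldings of
  the body nodes (`subs_unfold_subset`), hence number at most `|C| + 1` (`card_subs_unfold_le`), and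
  so do the AC-classes reachable from `topClass C` (`card_reach_topClass_le`) — the gate budget of
  the AC-canonical circuit of part 5;
* the node at position `i` unfolds to a formula of size `< 2^(i+2)` (`size_getD_unfoldList`), so
  `|C•| < 2^(|C|+1)` (`size_unfold_lt`) and every reachable class has `< 2^(|C|+1)` children counted
  with multiplicity (`card_kids_lt_of_mem_reach`) — the length of the doubling chains of part 5;
* the registered helper `stabilityAtACBudget_aux_cardReach`;
* the gate sets of the AC-canonical circuit of part 5: `leafSet t` / `nodeSet t` (reachable leaf /
  internal classes — leaf classes are determined by their label, `ACClass.eq_of_label_eq_of_isInput`)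
  and `pairSet t` ((parent, child) pairs), with their membership lemmas.

Everything proved; no named facts.
-/

-- single-problem summit: `Summit.ValiantsHypothesis.ValiantsHypothesis.…` is the namespace by design (D-0017)
set_option linter.dupNamespace false

noncomputable section

open scoped Classical

namespace Summit.ValiantsHypothesis.ValiantsHypothesis.Theorems

namespace ACStability

open Literature.Computability.AlgebraicComplexity ACClass

universe u v

variable {𝔽 : Type u} {X : Type v}

section Circuit

/-! ### Subformulas and size of an unfolding -/

variable [Zero 𝔽]

/-- `l.getD i d` is a member of `l` or the default. [folklore] -/
theorem getD_mem_or_eq {α : Type*} (l : List α) (i : ℕ) (d : α) : l.getD i d ∈ l ∨ l.getD i d = d := by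
  rcases lt_or_ge i l.length with h | h
  · left; rw [List.getD_eq_getElem _ _ h]; exact List.getElem_mem h
  · right; exact List.getD_eq_default _ _ h

/-- Subformulas of the unfolding of a node placed after nodes with unfoldings `vals`: the node's
unfolding itself, the junk leaf `0`, or subformulas of members of `vals`. [folklore] -/
theorem subs_unfold_node (vals : List (PIFormula 𝔽 X))
    (hv : ∀ v ∈ vals, ∀ K ∈ subs v, K ∈ vals ∨ K = .const 0) (nd : PICircuit.Node 𝔽 X) :
    ∀ K ∈ subs (nd.unfold vals), K = nd.unfold vals ∨ K ∈ vals ∨ K = .const 0 := by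
  intro K hK
  have harg : ∀ i, ∀ K ∈ subs (vals.getD i (.const 0)), K ∈ vals ∨ K = .const 0 := by
    intro i K hK
    rcases getD_mem_or_eq vals i (.const 0) with h | h
    · exact hv _ h K hK
    · rw [h] at hK; simp [subs] at hK; exact Or.inr hK
  cases nd with
  | var x => simp [PICircuit.Node.unfold, subs] at hK ⊢; exact Or.inl hK
  | const c => simp [PICircuit.Node.unfold, subs] at hK ⊢; exact Or.inl hK
  | add i j =>
    simp only [PICircuit.Node.unfold, subs, List.mem_cons, List.mem_append] at hK ⊢
    rcases hK with hK | hK | hK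
    · exact Or.inl hK
    · exact Or.inr (harg i K hK)
    · exact Or.inr (harg j K hK)
  | mul i j =>
    simp only [PICircuit.Node.unfold, subs, List.mem_cons, List.mem_append] at hK ⊢
    rcases hK with hK | hK | hK
    · exact Or.inl hK
    · exact Or.inr (harg i K hK)
    · exact Or.inr (harg j K hK)

/-- The list of node unfoldings is closed under subformulas up to the junk leaf `0`. [folklore] -/
theorem subs_unfoldList (init : List (PIFormula 𝔽 X))
    (hinit : ∀ v ∈ init, ∀ K ∈ subs v, K ∈ init ∨ K = .const 0) (body : List (PICircuit.Node 𝔽 X)) :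
    ∀ v ∈ PICircuit.unfoldList init body, ∀ K ∈ subs v,
      K ∈ PICircuit.unfoldList init body ∨ K = .const 0 := by
  induction body generalizing init with
  | nil => simpa using hinit
  | cons nd body ih =>
    rw [PICircuit.unfoldList_cons]
    refine ih _ fun v hv K hK => ?_
    rcases List.mem_append.1 hv with hv | hv
    · rcases hinit v hv K hK with h | h
      · exact Or.inl (List.mem_append_left _ h)
      · exact Or.inr h
    · simp only [List.mem_singleton] at hv
      subst hv
      rcases subs_unfold_node init hinit nd K hK with h | h | h
      · exact Or.inl (by simp [h])
      · exact Or.inl (List.mem_append_left _ h)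
      · exact Or.inr h

/-- The distinct subformulas of `C•` are among `C•`, the junk leaf `0` and the node unfoldings.
[folklore] -/
theorem subs_unfold_subset (C : PICircuit 𝔽 X) :
    (subs C.unfold).toFinset ⊆
      insert C.unfold (insert (.const 0) (PICircuit.unfoldList [] C.body).toFinset) := by
  intro K hK
  rw [List.mem_toFinset] at hK
  have hv := subs_unfoldList ([] : List (PIFormula 𝔽 X)) (by simp) C.body
  rcases subs_unfold_node _ hv C.out K hK with h | h | h
  · exact Finset.mem_insert.2 (Or.inl h)
  · exact Finset.mem_insert_of_mem (Finset.mem_insert_of_mem (List.mem_toFinset.2 h))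
  · exact Finset.mem_insert_of_mem (Finset.mem_insert.2 (Or.inl h))

/-- A circuit unfolds to a formula with at most `|C| + 1` distinct subformulas. [folklore] -/
theorem card_subs_unfold_le (C : PICircuit 𝔽 X) : (subs C.unfold).toFinset.card ≤ C.size + 1 := by
  refine (Finset.card_le_card (subs_unfold_subset C)).trans ?_
  refine (Finset.card_insert_le _ _).trans ?_
  have h1 := Finset.card_insert_le (PIFormula.const (0 : 𝔽) : PIFormula 𝔽 X)
    (PICircuit.unfoldList [] C.body).toFinset
  have h2 := List.toFinset_card_le (PICircuit.unfoldList ([] : List (PIFormula 𝔽 X)) C.body)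
  simp only [PICircuit.length_unfoldList, List.length_nil, zero_add] at h2
  simp only [PICircuit.size]
  omega

/-- **At most `|C| + 1` classes are reachable from the top class.** [folklore] -/
theorem card_reach_topClass_le (C : PICircuit 𝔽 X) : (reach (topClass C)).card ≤ C.size + 1 :=
  (Finset.card_le_card (reach_mk_subset C.unfold)).trans
    (Finset.card_image_le.trans (card_subs_unfold_le C))

/-- Size of node unfoldings: the node at position `i` unfolds to a formula of size `< 2^(i+2)`.
[folklore] -/
theorem size_getD_unfoldList (body : List (PICircuit.Node 𝔽 X)) :
    ∀ i, ((PICircuit.unfoldList [] body).getD i (.const 0)).size + 1 ≤ 2 ^ (i + 2) := by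
  suffices H : ∀ (init : List (PIFormula 𝔽 X)),
      (∀ i, (init.getD i (.const 0)).size + 1 ≤ 2 ^ (i + 2)) →
      ∀ i, ((PICircuit.unfoldList init body).getD i (.const 0)).size + 1 ≤ 2 ^ (i + 2) by
    refine H [] fun i => ?_
    simp only [List.getD_nil, PIFormula.size_const]
    calc (2 : ℕ) ≤ 2 ^ 1 := by norm_num
      _ ≤ 2 ^ (i + 2) := Nat.pow_le_pow_right (by norm_num) (by omega)
  induction body with
  | nil => intro init h; simpa using h
  | cons nd body ih =>
    intro init hinit
    rw [PICircuit.unfoldList_cons]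
    refine ih _ fun i => ?_
    rcases lt_trichotomy i init.length with hi | rfl | hi
    · rw [List.getD_append _ _ _ _ hi]; exact hinit i
    · rw [List.getD_append_right _ _ _ _ le_rfl, Nat.sub_self, List.getD_cons_zero]
      have harg : ∀ j, (init.getD j (.const 0 : PIFormula 𝔽 X)).size + 1 ≤ 2 ^ (init.length + 1) := by
        intro j
        rcases lt_or_ge j init.length with hj | hj
        · exact (hinit j).trans (Nat.pow_le_pow_right (by norm_num) (by omega))
        · rw [List.getD_eq_default _ _ hj]
          simp only [PIFormula.size_const]
          calc (2 : ℕ) = 2 ^ 1 := by norm_num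
            _ ≤ 2 ^ (init.length + 1) := Nat.pow_le_pow_right (by norm_num) (by omega)
      cases nd with
      | var x =>
        simp only [PICircuit.Node.unfold, PIFormula.size_var]
        calc (2 : ℕ) = 2 ^ 1 := by norm_num
          _ ≤ 2 ^ (init.length + 2) := Nat.pow_le_pow_right (by norm_num) (by omega)
      | const c =>
        simp only [PICircuit.Node.unfold, PIFormula.size_const]
        calc (2 : ℕ) = 2 ^ 1 := by norm_num
          _ ≤ 2 ^ (init.length + 2) := Nat.pow_le_pow_right (by norm_num) (by omega)
      | add j k =>
        simp only [PICircuit.Node.unfold, PIFormula.size_add]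
        have := harg j; have := harg k
        have h2 : 2 ^ (init.length + 2) = 2 ^ (init.length + 1) + 2 ^ (init.length + 1) := by ring
        omega
      | mul j k =>
        simp only [PICircuit.Node.unfold, PIFormula.size_mul]
        have := harg j; have := harg k
        have h2 : 2 ^ (init.length + 2) = 2 ^ (init.length + 1) + 2 ^ (init.length + 1) := by ring
        omega
    · rw [List.getD_eq_default _ _ (by simp; omega)]
      simp only [PIFormula.size_const]
      calc (2 : ℕ) = 2 ^ 1 := by norm_num
        _ ≤ 2 ^ (i + 2) := Nat.pow_le_pow_right (by norm_num) (by omega)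

/-- The unfolding of a circuit has size `< 2 ^ (|C| + 1)`. [folklore] -/
theorem size_unfold_lt (C : PICircuit 𝔽 X) : C.unfold.size < 2 ^ (C.size + 1) := by
  have key : C.unfold = (PICircuit.unfoldList [] C.nodes).getD C.body.length (.const 0) :=
    (PICircuit.getD_unfoldList_nodes C _).symm
  have h := size_getD_unfoldList C.nodes C.body.length
  have e : C.body.length + 2 = C.size + 1 := by simp only [PICircuit.size]
  rw [← key, e] at h
  omega

/-- **Multiplicity bound**: a class reachable from the top class has `< 2 ^ (|C| + 1)` children
(with multiplicity). [folklore] -/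
theorem card_kids_lt_of_mem_reach {C : PICircuit 𝔽 X} {q : ACClass 𝔽 X} (hq : q ∈ reach (topClass C)) :
    Multiset.card q.kids < 2 ^ (C.size + 1) := by
  obtain ⟨K, hK, rfl⟩ := exists_mem_subs_of_reaches (mem_reach.1 hq)
  calc Multiset.card (mk K).kids = (ACStability.kids K).length := by simp
    _ < K.size := length_kids_lt_size K
    _ ≤ C.unfold.size := size_le_of_mem_subs hK
    _ < 2 ^ (C.size + 1) := size_unfold_lt C

end Circuit

/-! ### Leaf classes are determined by their label -/

/-- Two classes with the same INPUT label are equal. [folklore] -/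
theorem ACClass.eq_of_label_eq_of_isInput {q q' : ACClass 𝔽 X} (h : q.label.IsInput)
    (hl : q.label = q'.label) : q = q' := by
  rcases hq : q.label with x | c | _ | _
  · have hq' : q'.label = .var x := hl ▸ hq
    rw [eq_mk_var_of_label hq, eq_mk_var_of_label hq']
  · have hq' : q'.label = .const c := hl ▸ hq
    rw [eq_mk_const_of_label hq, eq_mk_const_of_label hq']
  · simp [hq, CircuitLabel.IsInput] at h
  · simp [hq, CircuitLabel.IsInput] at h

/-! ### The gate sets -/

section GateSets

variable (t : ACClass 𝔽 X)

/-- Reachable leaf classes (variables and constants). [folklore] -/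
def leafSet : Finset (ACClass 𝔽 X) := (reach t).filter fun q => q.label.IsInput

/-- Reachable internal classes (`+` and `×`). [folklore] -/
def nodeSet : Finset (ACClass 𝔽 X) := (reach t).filter fun q => ¬ q.label.IsInput

/-- (parent, child) pairs of reachable classes. [folklore] -/
def pairSet : Finset (ACClass 𝔽 X × ACClass 𝔽 X) :=
  ((reach t) ×ˢ (reach t)).filter fun p => ¬ p.1.label.IsInput ∧ p.2 ∈ p.1.kids

variable {t}

/-- Membership in `leafSet`. [folklore] -/
@[simp] theorem mem_leafSet {q : ACClass 𝔽 X} : q ∈ leafSet t ↔ q ∈ reach t ∧ q.label.IsInput := by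
  simp [leafSet]

/-- Membership in `nodeSet`. [folklore] -/
@[simp] theorem mem_nodeSet {q : ACClass 𝔽 X} : q ∈ nodeSet t ↔ q ∈ reach t ∧ ¬ q.label.IsInput := by
  simp [nodeSet]

/-- Membership in `pairSet`. [folklore] -/
@[simp] theorem mem_pairSet {p : ACClass 𝔽 X × ACClass 𝔽 X} :
    p ∈ pairSet t ↔ (p.1 ∈ reach t ∧ p.2 ∈ reach t) ∧ ¬ p.1.label.IsInput ∧ p.2 ∈ p.1.kids := by
  simp [pairSet]

/-- A (parent, child) pair built from membership proofs. [folklore] -/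
def mkPair (q k : ACClass 𝔽 X) (hq : q ∈ reach t) (hn : ¬ q.label.IsInput) (hk : k ∈ q.kids) :
    {p // p ∈ pairSet t} :=
  ⟨(q, k), mem_pairSet.2 ⟨⟨hq, mem_reach_of_mem_kids hq hk⟩, hn, hk⟩⟩

/-- The child of a pair is reachable. [folklore] -/
theorem snd_mem_reach (p : {p // p ∈ pairSet t}) : p.1.2 ∈ reach t := (mem_pairSet.1 p.2).1.2

/-- The child of a pair is a child. [folklore] -/
theorem snd_mem_kids (p : {p // p ∈ pairSet t}) : p.1.2 ∈ p.1.1.kids := (mem_pairSet.1 p.2).2.2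

/-- The parent of a pair is internal. [folklore] -/
theorem not_isInput_fst (p : {p // p ∈ pairSet t}) : ¬ p.1.1.label.IsInput := (mem_pairSet.1 p.2).2.1

/-- The child of a pair is strictly smaller than the parent. [folklore] -/
theorem size_snd_lt (p : {p // p ∈ pairSet t}) : p.1.2.size < p.1.1.size :=
  ACClass.size_lt_of_mem_kids (snd_mem_kids p)

end GateSets

end ACStability

open Literature.Computability.AlgebraicComplexity in
/-- **Gate budget of the AC-canonical circuit** (registered helper of stub S3
`stub_stabilityAtACBudget`, crux `RestorationQP`): at most `|C| + 1` AC-classes are reachable from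
the class of the unfolding of a Hrubeš–Tzameret circuit `C`. [folklore] -/
theorem stabilityAtACBudget_aux_cardReach : ∀ (n : ℕ) (C : PICircuit ℂ (Fin n × Fin n)), (ACStability.ACClass.reach (ACStability.topClass C)).card ≤ C.size + 1 := by
  intro n C
  exact ACStability.card_reach_topClass_le C

end Summit.ValiantsHypothesis.ValiantsHypothesis.Theorems

end
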